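import Summits.ResolutionOfSingularities.ResolutionOfSingularities.Theorems.FrobeniusClosingSteerGeomChainAssembly
import Summits.ResolutionOfSingularities.ResolutionOfSingularities.Theorems.FrobeniusClosingSteerAbsoluteJacobianFinite
import Summits.ResolutionOfSingularities.ResolutionOfSingularities.Theorems.FrobeniusClosingSteerFreeChainHorizon
import HarnessLib

/-!
# Crux `Steer` (stmt-ResolutionOfSingularities-16345), chain W4.1: **hGW3 ASSEMBLER AT `e = 2`** (`d = 4`) — from I″ and the HORIZON BASE CHANGE K3ᴳ

OURS (campaign `res-hironaka`, rung L ★L-G4, slot W4.1; seat res-L0-w41-stub-2 g6; RULINGs 251 (c) / 263 (b); `hGW3-ASSEMBLY-MAP.md` v1.1 ac602735a6cfc835 §4;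
replaces the role of no printed item; NOT a statement of the manuscript under review [claim: Hironaka2017, status: under-review]; AI-produced). Theses-free,
DEFINITION-FREE: the two open pieces are BINDERS — `hI2` = I″ `NonRationalStepNotIsolated 4` (res-L0-w41-idea-3) VERBATIM, and `hK3G` = the HORIZON BASE
CHANGE word K3ᴳ in continuation-passing shape (the assembler's needs; construction = res-D-lib-1 / res-D-pv-040 K3-a/b/c + the easy half of K-GG4 (b)):
given the Geom chain with every step RATIONAL OR OF RESIDUE DEGREE 3 and a horizon `M`, SOME chain `S' : ℕ → Subring L'` with the perfect-free binders at every
member (regular · excellent · dimension 3 · quadratic transforms · exceptional parameters · laws of exponent 4 · isolated germs), RATIONAL steps below `M`, finite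
2-bases of every `κ(S' m)`, a dual 2-frame of `κ(Ŝ'₀)`, and the COMPARISON `ℓ(Ŝ'₀ ⧸ 𝒥_abs f̂'₀) ≤ ℓ(Ŝ₀ ⧸ 𝒥_abs f̂₀)`.

`GeomAssembly.geomChain_false_two_of_pieces (hI2) (hK3G)` : the body of `NoEternalConstOrderIsolatedChainGeom 2 3 4` (`IsGeomChart` unfolded, idle binders
omitted). PROOF: (A₂) every step is rational or a `(q, δ) = (3, 2)` step (CLAIM R + `star_of_deg_bound`-arithmetic + I″ at `d = 4`); (τ) `τ := ℓ(Ŝ₀ ⧸ 𝒥_abs f̂₀) < ∞`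
(`AbsJacobian.length_quotient_span_derivation_lt_top_of_chart`); K3ᴳ at horizon `τ + 3`; upstairs S_λ (`NoSatelliteStepTwoBasis.span_excParam_eq_of_rational_twoBasis`)
makes the steps `≤ τ + 1` free, `FreeChainHorizon.milnorLengthPlus_completion_ge_of_lt` at horizon `τ + 2` gives `τ + 1 ≤ ℓ' ≤ τ`. With p562692 (`e ≥ 3`) this
closes the T-line binder hGW3 `∀ e ≥ 2` modulo {I″, K3ᴳ}: `GeomAssembly.geomChain_false_of_pieces_all (hI2 : ∀ e ≥ 2, I″ at 2e) (hK3G) : ∀ e ≥ 2, <body at 2e>`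
is the T-line feeder shape (case split `e = 2` / `e ≥ 3`). [folklore]
-/

noncomputable section

set_option linter.dupNamespace false

open IsLocalRing
open Literature.AlgebraicGeometry.Resolution Literature.FieldTheory.Separability
open Summit.ResolutionOfSingularities.ResolutionOfSingularities.Theorems.SwitchingDichotomy
open Summit.ResolutionOfSingularities.ResolutionOfSingularities.Theorems.SwitchingDichotomy.SigmaTopLegality

namespace Summit.ResolutionOfSingularities.ResolutionOfSingularities.Theorems.SwitchingDichotomy.GeomAssembly

/-- The Bezout seam at `d = 4`: `δ(δ+1) ≤ 2q`, `2 ≤ q`, `(q, δ) ≠ (3, 2)` ⟹ `5δ < 3q`. -/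
theorem star_of_deg_bound_four {q δ : ℕ} (hδ : δ * (δ + 1) ≤ 2 * q) (hq : 2 ≤ q) (hne : ¬ (q = 3 ∧ δ = 2)) :
    δ * (2 * 2 + 1) < q * (2 * 2 - 1) := by
  norm_num
  rcases Nat.lt_or_ge δ 2 with hlt | hge
  · interval_cases δ <;> omega
  · rcases Nat.lt_or_ge δ 3 with hlt3 | hge3
    · have hδ2 : δ = 2 := by omega
      subst hδ2
      have hq3 : q ≠ 3 := fun h => hne ⟨h, rfl⟩
      omega
    · nlinarith

/-- **hGW3 ASSEMBLER AT `e = 2`** (two binders: I″ at `d = 4` and the horizon base change K3ᴳ in CPS form). See the module docstring. [folklore] -/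
theorem geomChain_false_two_of_pieces
    (hI2 : ∀ (L : Type) [Field L] [CharP L 2]
      (S₀ S₁ : Subring L) [IsLocalRing S₀] [IsLocalRing S₁] (h₀₁ : S₀ ≤ S₁)
      (f₀ g₀ G : S₀) (f₁ x₀ w : S₁) (q δ : ℕ) (u : Fin q → S₁),
      IsRegularLocalRing S₀ → IsRegularLocalRing S₁ → IsExcellentRing S₁ →
      ringKrullDim S₀ = 3 → ringKrullDim S₁ = 3 →
      IsQuadraticTransform S₀ S₁ →
      Ideal.span ((fun y : S₀ => (⟨(y : L), h₀₁ y.2⟩ : S₁)) '' (maximalIdeal S₀ : Set S₀)) = Ideal.span {x₀} →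
      Even (4 : ℕ) →
      ((f₁ : S₁) : L) * ((x₀ : S₁) : L) ^ (4 : ℕ) = ((f₀ : S₀) : L) - ((g₀ : S₀) : L) ^ 2 →
      (∃ g₁ : S₁, f₁ - g₁ ^ 2 ∈ maximalIdeal S₁ ^ (4 : ℕ)) →
      (∀ a : Fin q → S₀, (∑ i, (⟨((a i : S₀) : L), h₀₁ (a i).2⟩ : S₁) * u i) ∈ maximalIdeal S₁ →
        ∀ i, a i ∈ maximalIdeal S₀) →
      G ∈ maximalIdeal S₀ ^ δ → ((G : S₀) : L) = ((w : S₁) : L) * ((x₀ : S₁) : L) ^ δ →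
      (Ideal.span ({x₀, w} : Set S₁)).IsPrime →
      IsRegularLocalRing (S₁ ⧸ Ideal.span ({x₀, w} : Set S₁)) →
      ringKrullDim (S₁ ⧸ Ideal.span ({x₀, w} : Set S₁)) = 1 →
      δ * (4 + 1) < q * (4 - 1) →
      ¬ HasIsolatedSingularity (RadicandRing S₁ 2 f₁))
    (hK3G : ∀ (k L : Type) [Field k] [PerfectField k] [Field L] [CharP L 2] [Algebra k L]
      (S : ℕ → Subring L) [∀ m, IsLocalRing (S m)]
      (hle : ∀ m, S m ≤ S (m + 1)) (f g : ∀ m, S m) (x : ∀ m, S (m + 1)),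
      (∀ m, ∃ (A : Subalgebra k L) (Q : Ideal A), A.FG ∧ Q.IsPrime ∧ (∃ Q' : Ideal A, Q'.IsPrime ∧ Q < Q') ∧
        ∀ z : L, z ∈ S m ↔ ∃ a b : A, b ∉ Q ∧ z = (a : L) / (b : L)) →
      (∀ m, IsRegularLocalRing (S m)) → (∀ m, IsExcellentRing (S m)) → (∀ m, ringKrullDim (S m) = (3 : ℕ)) →
      (∀ m, IsQuadraticTransform (S m) (S (m + 1))) →
      (∀ m, Ideal.span ((fun y : S m => (⟨(y : L), hle m y.2⟩ : S (m + 1))) '' (maximalIdeal (S m) : Set (S m)))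
          = Ideal.span {x m}) →
      (∀ m, ((f (m + 1) : S (m + 1)) : L) * ((x m : S (m + 1)) : L) ^ (2 * 2) =
          ((f m : S m) : L) - ((g m : S m) : L) ^ 2) →
      (∀ m, HasIsolatedSingularity (RadicandRing (S m) 2 (f m))) →
      (∀ m, (∀ z : S (m + 1), ∃ s : S m, z - ⟨(s : L), hle m s.2⟩ ∈ maximalIdeal (S (m + 1))) ∨
        ∃ u : Fin 3 → S (m + 1),
          (∀ a : Fin 3 → S m, (∑ i, (⟨((a i : S m) : L), hle m (a i).2⟩ : S (m + 1)) * u i) ∈ maximalIdeal (S (m + 1)) →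
            ∀ i, a i ∈ maximalIdeal (S m)) ∧
          (∀ z : S (m + 1), ∃ a : Fin 3 → S m, z - ∑ i, (⟨((a i : S m) : L), hle m (a i).2⟩ : S (m + 1)) * u i ∈ maximalIdeal (S (m + 1)))) →
      ∀ (M : ℕ) (C : Prop),
        (∀ (L' : Type) [Field L'] [CharP L' 2] (S' : ℕ → Subring L') [∀ m, IsLocalRing (S' m)] [∀ m, IsNoetherianRing (S' m)]
          (hle' : ∀ m, S' m ≤ S' (m + 1)) (f' g' : ∀ m, S' m) (x' : ∀ m, S' (m + 1)),
          (∀ m, IsRegularLocalRing (S' m)) → (∀ m, IsExcellentRing (S' m)) → (∀ m, ringKrullDim (S' m) = (3 : ℕ)) →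
          (∀ m, IsQuadraticTransform (S' m) (S' (m + 1))) →
          (∀ m, Ideal.span ((fun y : S' m => (⟨(y : L'), hle' m y.2⟩ : S' (m + 1))) '' (maximalIdeal (S' m) : Set (S' m)))
              = Ideal.span {x' m}) →
          (∀ m, ((f' (m + 1) : S' (m + 1)) : L') * ((x' m : S' (m + 1)) : L') ^ (2 * 2) =
              ((f' m : S' m) : L') - ((g' m : S' m) : L') ^ 2) →
          (∀ m, HasIsolatedSingularity (RadicandRing (S' m) 2 (f' m))) →
          (∀ m, m < M → ∀ z : S' (m + 1), ∃ s : S' m, z - ⟨(s : L'), hle' m s.2⟩ ∈ maximalIdeal (S' (m + 1))) →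
          (∀ m, ∃ (r : ℕ) (b : Fin r → ResidueField (S' m)), TwoBasis.IsTwoBasis b) →
          (∃ (r : ℕ) (γ : Fin r → ResidueField (AdicCompletion (maximalIdeal (S' 0)) (S' 0)))
            (D : Fin r → Derivation ℤ (ResidueField (AdicCompletion (maximalIdeal (S' 0)) (S' 0)))
              (ResidueField (AdicCompletion (maximalIdeal (S' 0)) (S' 0)))),
            TwoBasis.IsTwoBasis γ ∧ ∀ l l', D l (γ l') = if l' = l then 1 else 0) →
          Module.length (AdicCompletion (maximalIdeal (S' 0)) (S' 0)) (AdicCompletion (maximalIdeal (S' 0)) (S' 0) ⧸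
              Ideal.span (Set.range fun Dv : Derivation ℤ (AdicCompletion (maximalIdeal (S' 0)) (S' 0)) (AdicCompletion (maximalIdeal (S' 0)) (S' 0)) =>
                Dv (algebraMap (S' 0) (AdicCompletion (maximalIdeal (S' 0)) (S' 0)) (f' 0)))) ≤
            Module.length (AdicCompletion (maximalIdeal (S 0)) (S 0)) (AdicCompletion (maximalIdeal (S 0)) (S 0) ⧸
              Ideal.span (Set.range fun Dv : Derivation ℤ (AdicCompletion (maximalIdeal (S 0)) (S 0)) (AdicCompletion (maximalIdeal (S 0)) (S 0)) =>
                Dv (algebraMap (S 0) (AdicCompletion (maximalIdeal (S 0)) (S 0)) (f 0)))) →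
          C) → C) :
    ∀ (k L : Type) [Field k] [PerfectField k] [Field L] [CharP L 2] [Algebra k L]
      (S : ℕ → Subring L) [∀ m, IsLocalRing (S m)]
      (hle : ∀ m, S m ≤ S (m + 1)) (f g : ∀ m, S m) (x : ∀ m, S (m + 1)),
      (∀ m, ∃ (A : Subalgebra k L) (Q : Ideal A), A.FG ∧ Q.IsPrime ∧ (∃ Q' : Ideal A, Q'.IsPrime ∧ Q < Q') ∧
        ∀ z : L, z ∈ S m ↔ ∃ a b : A, b ∉ Q ∧ z = (a : L) / (b : L)) →
      (∀ m, IsRegularLocalRing (S m)) → (∀ m, IsExcellentRing (S m)) → (∀ m, ringKrullDim (S m) = (3 : ℕ)) →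
      (∀ m, IsQuadraticTransform (S m) (S (m + 1))) →
      (∀ m, Ideal.span ((fun y : S m => (⟨(y : L), hle m y.2⟩ : S (m + 1))) '' (maximalIdeal (S m) : Set (S m)))
          = Ideal.span {x m}) →
      (∀ m, ((f (m + 1) : S (m + 1)) : L) * ((x m : S (m + 1)) : L) ^ (2 * 2) =
          ((f m : S m) : L) - ((g m : S m) : L) ^ 2) →
      (∀ m, HasIsolatedSingularity (RadicandRing (S m) 2 (f m))) →
      False := by
  intro k L _ _ _ _ _ S _ hle f g x hgeom hreg hexc hdim hqt hspan hlaw hiso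
  classical
  haveI : Fact (Nat.Prime 2) := ⟨Nat.prime_two⟩
  haveI : ∀ m, IsRegularLocalRing (S m) := hreg
  haveI : CharP k 2 := (algebraMap k L).charP (algebraMap k L).injective 2
  have hdim' : ∀ m, ringKrullDim (S m) = 3 := fun m => by rw [hdim m]; rfl
  -- ### (A₂) every step is rational or of residue degree `3`
  have hsep : ∀ m, (∀ z : S (m + 1), ∃ s : S m, z - ⟨(s : L), hle m s.2⟩ ∈ maximalIdeal (S (m + 1))) ∨
      ∃ u : Fin 3 → S (m + 1),
        (∀ a : Fin 3 → S m, (∑ i, (⟨((a i : S m) : L), hle m (a i).2⟩ : S (m + 1)) * u i) ∈ maximalIdeal (S (m + 1)) →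
          ∀ i, a i ∈ maximalIdeal (S m)) ∧
        (∀ z : S (m + 1), ∃ a : Fin 3 → S m, z - ∑ i, (⟨((a i : S m) : L), hle m (a i).2⟩ : S (m + 1)) * u i ∈ maximalIdeal (S (m + 1))) := by
    intro m
    by_cases hr : ∀ z : S (m + 1), ∃ s : S m, z - ⟨(s : L), hle m s.2⟩ ∈ maximalIdeal (S (m + 1))
    · exact Or.inl hr
    right
    have hnr := hr
    simp only [not_forall, not_exists] at hnr
    obtain ⟨A, Q, hA, hQ, hQ', hS⟩ := hgeom m
    have hinf : Infinite (ResidueField (S m)) := by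
      refine not_finite_iff_infinite.mp fun hfin => ?_
      exact GeomChain.geomChartResidueImperfect_holds 2 k L Nat.prime_two A Q (S m) hA hQ hQ' hS inferInstance
    obtain ⟨q, δ, u, G, w, hq2, hqind, hqspan, hG, hGw, hWp, hWreg, hWdim, hδ⟩ :=
      ClaimR.geomSupplyRegularCurve_holds L (S m) (S (m + 1)) (hle m) (x m) (hreg m) (hreg (m + 1)) (hexc m) (hdim' m) (hdim' (m + 1))
        (hqt m) (hspan m) hinf hnr
    by_cases h32 : q = 3 ∧ δ = 2
    · obtain ⟨rfl, -⟩ := h32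
      exact ⟨u, hqind, hqspan⟩
    · exfalso
      have hord : ∃ g₁ : S (m + 1), f (m + 1) - g₁ ^ 2 ∈ maximalIdeal (S (m + 1)) ^ (4 : ℕ) :=
        ⟨g (m + 1), CleaningOptimal.sub_pow_mem_pow_of_law 2 (hreg (m + 1)) (hqt (m + 1)) (hle (m + 1)) (f (m + 1)) (g (m + 1)) (f (m + 2))
          (x (m + 1)) 2 (hspan (m + 1)) (hlaw (m + 1))⟩
      exact hI2 L (S m) (S (m + 1)) (hle m) (f m) (g m) G (f (m + 1)) (x m) w q δ u (hreg m) (hreg (m + 1)) (hexc (m + 1))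
        (hdim' m) (hdim' (m + 1)) (hqt m) (hspan m) (by decide) (hlaw m) hord hqind hG hGw hWp hWreg hWdim
        (star_of_deg_bound_four hδ hq2 h32) (hiso (m + 1))
  -- ### (τ) the intrinsic colength downstairs
  obtain ⟨A, Q, hA, hQ, -, hS⟩ := hgeom 0
  have hτ := AbsJacobian.length_quotient_span_derivation_lt_top_of_chart k L A Q (S 0) (hreg 0) hA hQ hS (hexc 0) (hdim 0) (f 0) (hiso 0)
  obtain ⟨N, hN⟩ := ENat.ne_top_iff_exists.mp hτ.ne
  -- ### K3ᴳ at horizon `N + 3`, then S_λ and the horizon bound upstairs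
  refine hK3G k L S hle f g x hgeom hreg hexc hdim hqt hspan hlaw hiso hsep (N + 3) False ?_
  intro L' _ _ S' _ _ hle' f' g' x' hreg' hexc' hdim' hqt' hspan' hlaw' hiso' hrat' hB' hBhat' hcmp
  haveI : ∀ m, IsRegularLocalRing (S' m) := hreg'
  have hfree' : ∀ m, m < N + 2 →
      Ideal.span {(⟨((x' m : S' (m + 1)) : L'), hle' (m + 1) (x' m).2⟩ : S' (m + 2))} = Ideal.span {x' (m + 1)} := by
    intro m hm
    exact NoSatelliteStepTwoBasis.span_excParam_eq_of_rational_twoBasis 3 2 (by norm_num) le_rfl (hle' m) (hle' (m + 1)) (hle' (m + 2))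
      (hreg' m) (hreg' (m + 1)) (hreg' (m + 2)) (hdim' m) (hdim' (m + 1)) (hdim' (m + 2)) (hqt' m) (hqt' (m + 1)) (hqt' (m + 2))
      (f' m) (g' m) (f' (m + 1)) (g' (m + 1)) (f' (m + 2)) (g' (m + 2)) (f' (m + 3)) (x' m) (x' (m + 1)) (x' (m + 2))
      (hspan' m) (hspan' (m + 1)) (hspan' (m + 2)) (hlaw' m) (hlaw' (m + 1)) (hlaw' (m + 2))
      (hB' (m + 1)) (hexc' (m + 1)) (hiso' (m + 1)) (hrat' m (by omega)) (hrat' (m + 1) (by omega))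
  obtain ⟨r, γ, D, hBγ, hdual⟩ := hBhat'
  haveI : CharP (AdicCompletion (maximalIdeal (S' 0)) (S' 0)) 2 := RadicandCohenFrame.charP_adicCompletion 2 (S' 0)
  haveI : CharP (ResidueField (AdicCompletion (maximalIdeal (S' 0)) (S' 0))) 2 := RadicandCohenFrame.charP_residueField 2
  have hgen := TwoBasis.pAdjoin_eq_top_of_isTwoBasis γ hBγ
  have hge := (FreeChainHorizon.milnorLengthPlus_completion_ge_of_lt 2 (by norm_num) S' hle' f' g' x' hreg' (hexc' 0) hdim' hqt' hspan' hlaw'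
    (hiso' 0) γ D hdual hgen (M := N + 2) (by omega) (fun m hm => hfree' m hm) (fun m hm => hrat' m (by omega))).1
  have h := (hge.trans hcmp).trans_eq hN.symm
  have h' : N + 1 ≤ N := by exact_mod_cast h
  omega

/-- **hGW3, ALL `e ≥ 2`** — the T-line feeder shape `∀ e, 2 ≤ e → <body of NoEternalConstOrderIsolatedChainGeom 2 3 (2*e)>` from I″ (all exponents) and
K3ᴳ (used at `e = 2` only): case split `e = 2` (`geomChain_false_two_of_pieces`) / `e ≥ 3` (`geomChain_false_of_pieces`, p562692). [folklore] -/
theorem geomChain_false_of_pieces_all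
    (hI2 : ∀ (e : ℕ), 2 ≤ e → ∀ (L : Type) [Field L] [CharP L 2]
      (S₀ S₁ : Subring L) [IsLocalRing S₀] [IsLocalRing S₁] (h₀₁ : S₀ ≤ S₁)
      (f₀ g₀ G : S₀) (f₁ x₀ w : S₁) (q δ : ℕ) (u : Fin q → S₁),
      IsRegularLocalRing S₀ → IsRegularLocalRing S₁ → IsExcellentRing S₁ →
      ringKrullDim S₀ = 3 → ringKrullDim S₁ = 3 →
      IsQuadraticTransform S₀ S₁ →
      Ideal.span ((fun y : S₀ => (⟨(y : L), h₀₁ y.2⟩ : S₁)) '' (maximalIdeal S₀ : Set S₀)) = Ideal.span {x₀} →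
      Even (2 * e) →
      ((f₁ : S₁) : L) * ((x₀ : S₁) : L) ^ (2 * e) = ((f₀ : S₀) : L) - ((g₀ : S₀) : L) ^ 2 →
      (∃ g₁ : S₁, f₁ - g₁ ^ 2 ∈ maximalIdeal S₁ ^ (2 * e)) →
      (∀ a : Fin q → S₀, (∑ i, (⟨((a i : S₀) : L), h₀₁ (a i).2⟩ : S₁) * u i) ∈ maximalIdeal S₁ →
        ∀ i, a i ∈ maximalIdeal S₀) →
      G ∈ maximalIdeal S₀ ^ δ → ((G : S₀) : L) = ((w : S₁) : L) * ((x₀ : S₁) : L) ^ δ →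
      (Ideal.span ({x₀, w} : Set S₁)).IsPrime →
      IsRegularLocalRing (S₁ ⧸ Ideal.span ({x₀, w} : Set S₁)) →
      ringKrullDim (S₁ ⧸ Ideal.span ({x₀, w} : Set S₁)) = 1 →
      δ * (2 * e + 1) < q * (2 * e - 1) →
      ¬ HasIsolatedSingularity (RadicandRing S₁ 2 f₁))
    (hK3G : ∀ (k L : Type) [Field k] [PerfectField k] [Field L] [CharP L 2] [Algebra k L]
      (S : ℕ → Subring L) [∀ m, IsLocalRing (S m)]
      (hle : ∀ m, S m ≤ S (m + 1)) (f g : ∀ m, S m) (x : ∀ m, S (m + 1)),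
      (∀ m, ∃ (A : Subalgebra k L) (Q : Ideal A), A.FG ∧ Q.IsPrime ∧ (∃ Q' : Ideal A, Q'.IsPrime ∧ Q < Q') ∧
        ∀ z : L, z ∈ S m ↔ ∃ a b : A, b ∉ Q ∧ z = (a : L) / (b : L)) →
      (∀ m, IsRegularLocalRing (S m)) → (∀ m, IsExcellentRing (S m)) → (∀ m, ringKrullDim (S m) = (3 : ℕ)) →
      (∀ m, IsQuadraticTransform (S m) (S (m + 1))) →
      (∀ m, Ideal.span ((fun y : S m => (⟨(y : L), hle m y.2⟩ : S (m + 1))) '' (maximalIdeal (S m) : Set (S m)))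
          = Ideal.span {x m}) →
      (∀ m, ((f (m + 1) : S (m + 1)) : L) * ((x m : S (m + 1)) : L) ^ (2 * 2) =
          ((f m : S m) : L) - ((g m : S m) : L) ^ 2) →
      (∀ m, HasIsolatedSingularity (RadicandRing (S m) 2 (f m))) →
      (∀ m, (∀ z : S (m + 1), ∃ s : S m, z - ⟨(s : L), hle m s.2⟩ ∈ maximalIdeal (S (m + 1))) ∨
        ∃ u : Fin 3 → S (m + 1),
          (∀ a : Fin 3 → S m, (∑ i, (⟨((a i : S m) : L), hle m (a i).2⟩ : S (m + 1)) * u i) ∈ maximalIdeal (S (m + 1)) →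
            ∀ i, a i ∈ maximalIdeal (S m)) ∧
          (∀ z : S (m + 1), ∃ a : Fin 3 → S m, z - ∑ i, (⟨((a i : S m) : L), hle m (a i).2⟩ : S (m + 1)) * u i ∈ maximalIdeal (S (m + 1)))) →
      ∀ (M : ℕ) (C : Prop),
        (∀ (L' : Type) [Field L'] [CharP L' 2] (S' : ℕ → Subring L') [∀ m, IsLocalRing (S' m)] [∀ m, IsNoetherianRing (S' m)]
          (hle' : ∀ m, S' m ≤ S' (m + 1)) (f' g' : ∀ m, S' m) (x' : ∀ m, S' (m + 1)),
          (∀ m, IsRegularLocalRing (S' m)) → (∀ m, IsExcellentRing (S' m)) → (∀ m, ringKrullDim (S' m) = (3 : ℕ)) →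
          (∀ m, IsQuadraticTransform (S' m) (S' (m + 1))) →
          (∀ m, Ideal.span ((fun y : S' m => (⟨(y : L'), hle' m y.2⟩ : S' (m + 1))) '' (maximalIdeal (S' m) : Set (S' m)))
              = Ideal.span {x' m}) →
          (∀ m, ((f' (m + 1) : S' (m + 1)) : L') * ((x' m : S' (m + 1)) : L') ^ (2 * 2) =
              ((f' m : S' m) : L') - ((g' m : S' m) : L') ^ 2) →
          (∀ m, HasIsolatedSingularity (RadicandRing (S' m) 2 (f' m))) →
          (∀ m, m < M → ∀ z : S' (m + 1), ∃ s : S' m, z - ⟨(s : L'), hle' m s.2⟩ ∈ maximalIdeal (S' (m + 1))) →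
          (∀ m, ∃ (r : ℕ) (b : Fin r → ResidueField (S' m)), TwoBasis.IsTwoBasis b) →
          (∃ (r : ℕ) (γ : Fin r → ResidueField (AdicCompletion (maximalIdeal (S' 0)) (S' 0)))
            (D : Fin r → Derivation ℤ (ResidueField (AdicCompletion (maximalIdeal (S' 0)) (S' 0)))
              (ResidueField (AdicCompletion (maximalIdeal (S' 0)) (S' 0)))),
            TwoBasis.IsTwoBasis γ ∧ ∀ l l', D l (γ l') = if l' = l then 1 else 0) →
          Module.length (AdicCompletion (maximalIdeal (S' 0)) (S' 0)) (AdicCompletion (maximalIdeal (S' 0)) (S' 0) ⧸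
              Ideal.span (Set.range fun Dv : Derivation ℤ (AdicCompletion (maximalIdeal (S' 0)) (S' 0)) (AdicCompletion (maximalIdeal (S' 0)) (S' 0)) =>
                Dv (algebraMap (S' 0) (AdicCompletion (maximalIdeal (S' 0)) (S' 0)) (f' 0)))) ≤
            Module.length (AdicCompletion (maximalIdeal (S 0)) (S 0)) (AdicCompletion (maximalIdeal (S 0)) (S 0) ⧸
              Ideal.span (Set.range fun Dv : Derivation ℤ (AdicCompletion (maximalIdeal (S 0)) (S 0)) (AdicCompletion (maximalIdeal (S 0)) (S 0)) =>
                Dv (algebraMap (S 0) (AdicCompletion (maximalIdeal (S 0)) (S 0)) (f 0)))) →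
          C) → C) :
    ∀ (e : ℕ), 2 ≤ e →
    ∀ (k L : Type) [Field k] [PerfectField k] [Field L] [CharP L 2] [Algebra k L]
      (S : ℕ → Subring L) [∀ m, IsLocalRing (S m)]
      (hle : ∀ m, S m ≤ S (m + 1)) (f g : ∀ m, S m) (x : ∀ m, S (m + 1)),
      (∀ m, ∃ (A : Subalgebra k L) (Q : Ideal A), A.FG ∧ Q.IsPrime ∧ (∃ Q' : Ideal A, Q'.IsPrime ∧ Q < Q') ∧
        ∀ z : L, z ∈ S m ↔ ∃ a b : A, b ∉ Q ∧ z = (a : L) / (b : L)) →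
      (∀ m, IsRegularLocalRing (S m)) → (∀ m, IsExcellentRing (S m)) → (∀ m, ringKrullDim (S m) = (3 : ℕ)) →
      (∀ m, IsQuadraticTransform (S m) (S (m + 1))) →
      (∀ m, Ideal.span ((fun y : S m => (⟨(y : L), hle m y.2⟩ : S (m + 1))) '' (maximalIdeal (S m) : Set (S m)))
          = Ideal.span {x m}) →
      (∀ m, ((f (m + 1) : S (m + 1)) : L) * ((x m : S (m + 1)) : L) ^ (2 * e) =
          ((f m : S m) : L) - ((g m : S m) : L) ^ 2) →
      (∀ m, HasIsolatedSingularity (RadicandRing (S m) 2 (f m))) →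
      False := by
  intro e he
  rcases Nat.lt_or_ge e 3 with hlt | hge
  · obtain rfl : e = 2 := by omega
    exact geomChain_false_two_of_pieces (hI2 2 le_rfl) hK3G
  · exact geomChain_false_of_pieces hge (hI2 e he)

end Summit.ResolutionOfSingularities.ResolutionOfSingularities.Theorems.SwitchingDichotomy.GeomAssembly

end
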